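import Mathlib.Algebra.Homology.DerivedCategory.Ext.ExactSequences
import Mathlib.Algebra.Homology.DerivedCategory.Ext.EnoughProjectives
import Mathlib.Algebra.Homology.ShortComplex.Ab
import HarnessLib

/-!
# `Extⁿ(X, Y) ≅ Hⁿ(Ext⁰(P•, Y))` for an exact augmented CHAIN complex `⋯ → P₁ → P₀ → X → 0` with
# `Ext(–, Y)`-acyclic (e.g. projective) terms — dimension shifting in the first variable

Topic `Algebra/Homology`; namespace `Literature.Algebra.Homology.LeftResolution`.  Definitions with
bodies and theorems; Mathlib-only imports; no named fact, no instance, no `sorry`.  The mirror image of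
the tree's `ExtOfAcyclicResolution` (door-c4 g13: `Extⁿ(X, M) ≅ Hⁿ(Ext⁰(X, I•))` for an exact
`Ext(X, –)`-acyclic COCHAIN resolution `M → I•` of the SECOND variable), now resolving the FIRST
variable: for Mathlib's `Abelian.Ext` (derived category, `HasExt`) in any abelian category `C`, a
chain complex `P : ChainComplex C ℕ` with an augmentation `ε : P₀ → X` such that `P₁ → P₀ → X → 0`
is exact, `P` is exact in every positive degree, and `Ext^{q+1}(Pₙ, Y) = 0` for all `n, q`
(every projective resolution qualifies, `Ext.eq_zero_of_projective`), there are isomorphisms of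
abelian groups

* **`extAddEquivHomologyZero : Ext⁰(X, Y) ≃+ H⁰(Hom(P•, Y))`** (no acyclicity needed),
* **`extAddEquivHomologySucc : Extⁿ⁺¹(X, Y) ≃+ Hⁿ⁺¹(Hom(P•, Y))`**,

where `Hom(P•, Y) = homComplex P Y` is the cochain complex of abelian groups `n ↦ Ext⁰(Pₙ, Y)` with
differential "precompose with `d : Pₙ₊₁ → Pₙ`" (Weibel, *An introduction to homological algebra*,
§2.4 dimension shifting / Ex. 2.4.3 and Thm. 2.7.6 "`Ext` may be computed from a projective resolution
of the first variable"; Brown, *Cohomology of Groups*, III §1–§2).  The proof is dimension shifting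
along the short exact sequences `0 → Qₙ₊₁ → Pₙ → Qₙ → 0` of OPCYCLES (`Qₙ = coker(Pₙ₊₁ → Pₙ)`,
Mathlib `HomologicalComplex.opcycles`), using Mathlib's contravariant long exact sequence of `Ext`
(`Ext.contravariant_sequence_exact₁/₃`): `Extⁿ⁺¹(X, Y) ≅ Extⁿ⁺¹(Q₀, Y) ≅ Ext¹(Qₙ, Y) ≅
Ext⁰(Qₙ₊₁, Y) / Im Ext⁰(Pₙ, Y) ≅ ker dⁿ⁺¹ / Im dⁿ`.

Consumer (sequel `RepExtGroupCohomology`): with Mathlib's standard resolution of the trivial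
representation and the tree's `ResolutionComparison.resolutionIso`, the identification
`Extⁿ_{Rep k G}(k, A) ≃+ Hⁿ(G, A)` of Mathlib's derived-category `Ext` with Mathlib's
`groupCohomology` — the finite-layer currency of the Poitou–Tate programme (crux
`stmt-BirchSwinnertonDyer-19295`, cell `bsd-schneider-ideate`, seat door-c4 gen 14).

## What is here
* §1 dimension shifting along one short exact sequence in the FIRST variable:
  `extClass_precomp_surjective/_injective`, `shiftAddEquiv` (`Extᵃ(S.X₁, Y) ≃+ Extᵇ(S.X₃, Y)`,
  `b = 1 + a`, when `Ext(S.X₂, Y)` vanishes in degrees `a, b`), `ker_extClass_precomp_eq_range`,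
  `extOneQuotientAddEquiv` (`Ext¹(S.X₃, Y) ≃+ Ext⁰(S.X₁, Y) ⧸ Im Ext⁰(S.X₂, Y)`).
* §2 `extAddEquivOfIsoLeft` (transport along `X ≅ X'`).
* §3 the opcycles short exact sequences `opcyclesSC P n : Qₙ₊₁ → Pₙ → Qₙ` of a chain complex
  (`opcyclesSC_exact`, `mono_fromOpcycles_of_exactAt`, `opcyclesSC_shortExact`), `iterShift`,
  `isoOpcyclesZero : P.opcycles 0 ≅ X` for an exact augmentation.
* §4 the complex `homComplex P Y` (`n ↦ Ext⁰(Pₙ, Y)`), `homComplex_d_apply`, right exactness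
  `opcyclesExtAddEquiv : Ext⁰(Qⱼ, Y) ≃+ ker(Ext⁰(Pⱼ, Y) → Ext⁰(Pⱼ₊₁, Y))` and its bookkeeping.
* §5 the main results `extAddEquivHomologyZero`, `extAddEquivHomologySucc`.

## References
* C. A. Weibel, *An introduction to homological algebra* (1994), §2.4 (Ex. 2.4.3), §2.5, Thm. 2.7.6.
  [Weibel1994]
* K. S. Brown, *Cohomology of Groups*, GTM 87 (1982), III §1–§2. [Brown1982CohomologyGroups]
-/

noncomputable section

universe w v u

namespace Literature.Algebra.Homology

namespace LeftResolution

open CategoryTheory CategoryTheory.Limits CategoryTheory.Abelian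

variable {C : Type u} [Category.{v} C] [Abelian C] [HasExt.{w} C]

/-- Unfolding of Mathlib's `Ext.precomp`: `α.precomp Z h x = α.comp x h`. [folklore] -/
private theorem precomp_apply {X Y : C} (Z : C) {n a b : ℕ} (α : Ext X Y n) (h : n + a = b)
    (x : Ext Y Z a) : α.precomp Z h x = α.comp x h := rfl

/-! ## §1 Dimension shifting along one short exact sequence, first variable -/

section Shift

variable (Y : C) {S : ShortComplex C} (hS : S.ShortExact)

/-- If `Extᵇ(S.X₂, Y) = 0` then the connecting map `δ : Extᵃ(S.X₁, Y) → Extᵇ(S.X₃, Y)` (`b = 1 + a`)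
is surjective (exactness of `Extᵃ(S.X₁, Y) → Extᵇ(S.X₃, Y) → Extᵇ(S.X₂, Y)`).
[cite: Weibel1994, §2.4 (dimension shifting, Exercise 2.4.3)] -/
theorem extClass_precomp_surjective {a b : ℕ} (h : 1 + a = b)
    (hb : ∀ e : Ext S.X₂ Y b, e = 0) :
    Function.Surjective (hS.extClass.precomp Y h) := by
  intro y
  obtain ⟨x, hx⟩ := Ext.contravariant_sequence_exact₃ (hS := hS) (Y := Y) y (hb _) h
  exact ⟨x, hx⟩

/-- If `Extᵃ(S.X₂, Y) = 0` then the connecting map `δ : Extᵃ(S.X₁, Y) → Extᵇ(S.X₃, Y)` (`b = 1 + a`)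
is injective (exactness of `Extᵃ(S.X₂, Y) → Extᵃ(S.X₁, Y) → Extᵇ(S.X₃, Y)`).
[cite: Weibel1994, §2.4 (dimension shifting, Exercise 2.4.3)] -/
theorem extClass_precomp_injective {a b : ℕ} (h : 1 + a = b)
    (ha : ∀ e : Ext S.X₂ Y a, e = 0) :
    Function.Injective (hS.extClass.precomp Y h) := by
  rw [injective_iff_map_eq_zero]
  intro x hx
  obtain ⟨y, rfl⟩ := Ext.contravariant_sequence_exact₁ (hS := hS) (Y := Y) x h hx
  rw [ha y, Ext.comp_zero]

/-- **Dimension shifting in the first variable.**  If `Extᵃ(S.X₂, Y) = 0 = Extᵇ(S.X₂, Y)`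
(`b = 1 + a`) then `δ : Extᵃ(S.X₁, Y) ≃+ Extᵇ(S.X₃, Y)`.
[cite: Weibel1994, §2.4 (dimension shifting, Exercise 2.4.3)] -/
def shiftAddEquiv {a b : ℕ} (h : 1 + a = b) (ha : ∀ e : Ext S.X₂ Y a, e = 0)
    (hb : ∀ e : Ext S.X₂ Y b, e = 0) : Ext S.X₁ Y a ≃+ Ext S.X₃ Y b :=
  AddEquiv.ofBijective (hS.extClass.precomp Y h)
    ⟨extClass_precomp_injective Y hS h ha, extClass_precomp_surjective Y hS h hb⟩

/-- Formula: `shiftAddEquiv` is precomposition with the class of `S`.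
[cite: Weibel1994, §2.4 (dimension shifting, Exercise 2.4.3)] -/
@[simp]
theorem shiftAddEquiv_apply {a b : ℕ} (h : 1 + a = b) (ha : ∀ e : Ext S.X₂ Y a, e = 0)
    (hb : ∀ e : Ext S.X₂ Y b, e = 0) (x : Ext S.X₁ Y a) :
    shiftAddEquiv Y hS h ha hb x = hS.extClass.comp x h := rfl

/-- The kernel of `δ : Ext⁰(S.X₁, Y) → Ext¹(S.X₃, Y)` is the image of `Ext⁰(S.X₂, Y)`.
[cite: Weibel1994, §2.4 (dimension shifting, Exercise 2.4.3)] -/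
theorem ker_extClass_precomp_eq_range :
    (hS.extClass.precomp Y (add_zero 1)).ker =
      ((Ext.mk₀ S.f).precomp Y (zero_add 0)).range := by
  ext x
  simp only [AddMonoidHom.mem_ker, AddMonoidHom.mem_range, precomp_apply]
  constructor
  · intro hx
    exact Ext.contravariant_sequence_exact₁ (hS := hS) (Y := Y) x (add_zero 1) hx
  · rintro ⟨y, rfl⟩
    exact hS.extClass_comp_assoc y

/-- **`Ext¹(S.X₃, Y) ≃+ Ext⁰(S.X₁, Y) ⧸ Im Ext⁰(S.X₂, Y)`** when `Ext¹(S.X₂, Y) = 0` (the bottom of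
the dimension shift). [cite: Weibel1994, §2.4 (dimension shifting, Exercise 2.4.3)] -/
def extOneQuotientAddEquiv (h1 : ∀ e : Ext S.X₂ Y 1, e = 0) :
    Ext S.X₃ Y 1 ≃+ Ext S.X₁ Y 0 ⧸ ((Ext.mk₀ S.f).precomp Y (zero_add 0)).range :=
  ((QuotientAddGroup.quotientAddEquivOfEq (ker_extClass_precomp_eq_range Y hS)).symm.trans
    (QuotientAddGroup.quotientKerEquivOfSurjective _
      (extClass_precomp_surjective Y hS (add_zero 1) h1))).symm

/-- Formula: the inverse of `extOneQuotientAddEquiv` sends the class of `x : Ext⁰(S.X₁, Y)` to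
`δ x = [S] ∘ x`. [cite: Weibel1994, §2.4 (dimension shifting, Exercise 2.4.3)] -/
theorem extOneQuotientAddEquiv_symm_mk (h1 : ∀ e : Ext S.X₂ Y 1, e = 0) (x : Ext S.X₁ Y 0) :
    (extOneQuotientAddEquiv Y hS h1).symm (QuotientAddGroup.mk x) =
      hS.extClass.comp x (add_zero 1) := rfl

end Shift

/-! ## §2 Transport of `Ext` along an isomorphism of the first variable -/

/-- `Ext · Y n` transported along an isomorphism `X ≅ X'`: `x ↦ e⁻¹ ∘ x`.
[cite: Weibel1994, §2.7] -/
def extAddEquivOfIsoLeft {X X' : C} (e : X ≅ X') (Y : C) (n : ℕ) : Ext X Y n ≃+ Ext X' Y n where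
  toFun x := (Ext.mk₀ e.inv).comp x (zero_add n)
  invFun x' := (Ext.mk₀ e.hom).comp x' (zero_add n)
  left_inv x := by
    change (Ext.mk₀ e.hom).comp ((Ext.mk₀ e.inv).comp x (zero_add n)) (zero_add n) = x
    rw [Ext.mk₀_comp_mk₀_assoc, Iso.hom_inv_id, Ext.mk₀_id_comp]
  right_inv x' := by
    change (Ext.mk₀ e.inv).comp ((Ext.mk₀ e.hom).comp x' (zero_add n)) (zero_add n) = x'
    rw [Ext.mk₀_comp_mk₀_assoc, Iso.inv_hom_id, Ext.mk₀_id_comp]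
  map_add' x y := Ext.comp_add _ _ _ _

/-- Formula: `extAddEquivOfIsoLeft e Y n x = e.inv ∘ x`. [cite: Weibel1994, §2.7] -/
@[simp]
theorem extAddEquivOfIsoLeft_apply {X X' : C} (e : X ≅ X') (Y : C) (n : ℕ) (x : Ext X Y n) :
    extAddEquivOfIsoLeft e Y n x = (Ext.mk₀ e.inv).comp x (zero_add n) := rfl

/-! ## §3 The short exact sequences `0 → Qₙ₊₁ → Pₙ → Qₙ → 0` of opcycles of a chain complex -/

section Opcycles

variable (P : ChainComplex C ℕ)

omit [HasExt C] in
/-- `(Qₙ₊₁ → Pₙ) ≫ p_{Qₙ} = 0`. [cite: Weibel1994, §2.4 (dimension shifting, Exercise 2.4.3)] -/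
theorem fromOpcycles_pOpcycles (n : ℕ) : P.fromOpcycles (n + 1) n ≫ P.pOpcycles n = 0 := by
  rw [← cancel_epi (P.pOpcycles (n + 1)), HomologicalComplex.p_fromOpcycles_assoc, comp_zero,
    HomologicalComplex.d_pOpcycles]

/-- The short complex `Qₙ₊₁ → Pₙ —p→ Qₙ` (`Qₙ = P.opcycles n = coker(Pₙ₊₁ → Pₙ)`, the first map the
factorisation of `d : Pₙ₊₁ → Pₙ` through `Qₙ₊₁`). [cite: Weibel1994, §2.4 (dimension shifting, Exercise 2.4.3)] -/
abbrev opcyclesSC (n : ℕ) : ShortComplex C :=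
  ShortComplex.mk (P.fromOpcycles (n + 1) n) (P.pOpcycles n) (fromOpcycles_pOpcycles P n)

omit [HasExt C] in
/-- `Qₙ₊₁ → Pₙ → Qₙ` is exact (because `Pₙ₊₁ → Pₙ → Qₙ` is, `Qₙ` being the cokernel of `d`, and
`Pₙ₊₁ → Qₙ₊₁` is an epimorphism). [cite: Weibel1994, §2.4 (dimension shifting, Exercise 2.4.3)] -/
theorem opcyclesSC_exact (n : ℕ) : (opcyclesSC P n).Exact := by
  have h : (ShortComplex.mk (P.d (n + 1) n) (P.pOpcycles n) (by simp)).Exact :=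
    ShortComplex.exact_of_g_is_cokernel _
      (P.opcyclesIsCokernel (n + 1) n (ChainComplex.prev ℕ n))
  let φ : ShortComplex.mk (P.d (n + 1) n) (P.pOpcycles n) (by simp) ⟶ opcyclesSC P n :=
    { τ₁ := P.pOpcycles (n + 1)
      τ₂ := 𝟙 (P.X n)
      τ₃ := 𝟙 (P.opcycles n)
      comm₁₂ := by simp
      comm₂₃ := by simp }
  haveI : Epi φ.τ₁ := inferInstanceAs (Epi (P.pOpcycles (n + 1)))
  haveI : IsIso φ.τ₂ := inferInstanceAs (IsIso (𝟙 (P.X n)))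
  haveI : Mono φ.τ₃ := inferInstanceAs (Mono (𝟙 (P.opcycles n)))
  exact (ShortComplex.exact_iff_of_epi_of_isIso_of_mono φ).1 h

omit [HasExt C] in
/-- If `P` is exact in degree `n + 1` then `Qₙ₊₁ → Pₙ` is a monomorphism.
[cite: Weibel1994, §2.4 (dimension shifting, Exercise 2.4.3)] -/
theorem mono_fromOpcycles_of_exactAt (n : ℕ) (h : P.ExactAt (n + 1)) :
    Mono (P.fromOpcycles (n + 1) n) := by
  have hi : (ComplexShape.down ℕ).prev (n + 1) = n + 1 + 1 := ChainComplex.prev ℕ (n + 1)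
  have hk : (ComplexShape.down ℕ).next (n + 1) = n := ChainComplex.next_nat_succ n
  rw [P.exactAt_iff' (n + 1 + 1) (n + 1) n hi hk] at h
  have h' : Mono ((P.opcyclesIsoSc' (n + 1 + 1) (n + 1) n hi hk).inv ≫ P.fromOpcycles (n + 1) n) := by
    rw [HomologicalComplex.opcyclesIsoSc'_inv_fromOpcycles]
    exact h.mono_fromOpcycles
  have h'' := mono_comp (P.opcyclesIsoSc' (n + 1 + 1) (n + 1) n hi hk).hom
    ((P.opcyclesIsoSc' (n + 1 + 1) (n + 1) n hi hk).inv ≫ P.fromOpcycles (n + 1) n)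
  rwa [Iso.hom_inv_id_assoc] at h''

omit [HasExt C] in
/-- **`0 → Qₙ₊₁ → Pₙ → Qₙ → 0` is short exact** when `P` is exact in degree `n + 1`.
[cite: Weibel1994, §2.4 (dimension shifting, Exercise 2.4.3)] -/
theorem opcyclesSC_shortExact (n : ℕ) (h : P.ExactAt (n + 1)) : (opcyclesSC P n).ShortExact :=
  haveI := mono_fromOpcycles_of_exactAt P n h
  ShortComplex.ShortExact.mk' (opcyclesSC_exact P n) this (inferInstanceAs (Epi (P.pOpcycles n)))

variable (Y : C)

/-- **Iterated dimension shifting**: for an exact chain complex with `Ext(–, Y)`-acyclic terms,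
`Ext^{a+1}(Qₙ, Y) ≃+ Ext^{a+1+n}(Q₀, Y)`. [cite: Weibel1994, §2.4 (dimension shifting, Exercise 2.4.3)] -/
def iterShift (hP : ∀ n, P.ExactAt (n + 1)) (hY : ∀ n q (e : Ext (P.X n) Y (q + 1)), e = 0) :
    (n : ℕ) → {a b : ℕ} → (a + 1 + n = b) → (Ext (P.opcycles n) Y (a + 1) ≃+ Ext (P.opcycles 0) Y b)
  | 0, _, _, h => by subst h; exact AddEquiv.refl _
  | n + 1, a, _, h =>
    (shiftAddEquiv Y (opcyclesSC_shortExact P n (hP n)) (by omega : 1 + (a + 1) = a + 1 + 1) (hY n a)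
      (hY n (a + 1))).trans (iterShift hP hY n (a := a + 1) (by omega))

variable {X : C} (ε : P.X 0 ⟶ X) (hε : P.d 1 0 ≫ ε = 0)

omit [HasExt C] in
/-- For an exact augmentation `P₁ → P₀ —ε→ X → 0` (`ε` epi and `P₁ → P₀ → X` exact), `Q₀ ≅ X`
(Mathlib's `ChainComplex.isIso_descOpcycles_iff`). [cite: Weibel1994, §2.4 (dimension shifting, Exercise 2.4.3)] -/
def isoOpcyclesZero (hex : (ShortComplex.mk (P.d 1 0) ε hε).Exact) [Epi ε] : P.opcycles 0 ≅ X :=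
  haveI := (ChainComplex.isIso_descOpcycles_iff P ε hε).2 ⟨hex, inferInstance⟩
  asIso (P.descOpcycles ε 1 (ChainComplex.prev ℕ 0) hε)

omit [HasExt C] in
/-- `p_{Q₀} ≫ (isoOpcyclesZero …).hom = ε`. [cite: Weibel1994, §2.4 (dimension shifting, Exercise 2.4.3)] -/
@[simp]
theorem pOpcycles_isoOpcyclesZero_hom (hex : (ShortComplex.mk (P.d 1 0) ε hε).Exact) [Epi ε] :
    P.pOpcycles 0 ≫ (isoOpcyclesZero P ε hε hex).hom = ε := by
  simp [isoOpcyclesZero]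

end Opcycles

/-! ## §4 The complex `Ext⁰(P•, Y)` and its cycles -/

section HomComplex

variable (P : ChainComplex C ℕ) (Y : C)

/-- `d ≫ d = 0` for precomposition on `Ext⁰`. [cite: Weibel1994, §2.7] -/
theorem precomp_d_comp_precomp_d (n : ℕ) :
    AddCommGrpCat.ofHom ((Ext.mk₀ (P.d (n + 1) n)).precomp Y (zero_add 0)) ≫
      AddCommGrpCat.ofHom ((Ext.mk₀ (P.d (n + 1 + 1) (n + 1))).precomp Y (zero_add 0)) = 0 := by
  ext x
  change (Ext.mk₀ (P.d (n + 1 + 1) (n + 1))).comp ((Ext.mk₀ (P.d (n + 1) n)).comp x (zero_add 0))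
    (zero_add 0) = 0
  rw [Ext.mk₀_comp_mk₀_assoc, HomologicalComplex.d_comp_d, Ext.mk₀_zero, Ext.zero_comp]

/-- **The complex `Ext⁰(P₀, Y) → Ext⁰(P₁, Y) → ⋯` of abelian groups** (`Ext⁰ = Hom`; differential
= precomposition with `d : Pₙ₊₁ → Pₙ`). [cite: Weibel1994, §2.7 (Theorem 2.7.6)] -/
def homComplex : CochainComplex AddCommGrpCat.{w} ℕ :=
  CochainComplex.of (fun n => AddCommGrpCat.of (Ext (P.X n) Y 0))
    (fun n => AddCommGrpCat.ofHom ((Ext.mk₀ (P.d (n + 1) n)).precomp Y (zero_add 0)))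
    (precomp_d_comp_precomp_d P Y)

/-- The differential of `homComplex P Y` is precomposition with `d`.
[cite: Weibel1994, §2.7 (Theorem 2.7.6)] -/
theorem homComplex_d (n : ℕ) :
    (homComplex P Y).d n (n + 1) =
      AddCommGrpCat.ofHom ((Ext.mk₀ (P.d (n + 1) n)).precomp Y (zero_add 0)) := by
  dsimp only [homComplex]
  exact CochainComplex.of_d _ _ n

/-- The differential of `homComplex P Y`, elementwise. [cite: Weibel1994, §2.7 (Theorem 2.7.6)] -/
theorem homComplex_d_apply (n : ℕ) (x : Ext (P.X n) Y 0) :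
    ((homComplex P Y).d n (n + 1)).hom x = (Ext.mk₀ (P.d (n + 1) n)).comp x (zero_add 0) := by
  rw [homComplex_d]
  rfl

/-- In the window `(i, j, j+1)` the second map of `(homComplex P Y).sc'` is precomposition with `d`.
[cite: Weibel1994, §2.7 (Theorem 2.7.6)] -/
theorem homComplex_sc'_g_apply (i j : ℕ) (x : Ext (P.X j) Y 0) :
    ((homComplex P Y).sc' i j (j + 1)).g.hom x = (Ext.mk₀ (P.d (j + 1) j)).comp x (zero_add 0) :=
  homComplex_d_apply P Y j x

/-- In the window `(n, n+1, k)` the first map of `(homComplex P Y).sc'` is precomposition with `d`.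
[cite: Weibel1994, §2.7 (Theorem 2.7.6)] -/
theorem homComplex_sc'_f_apply (n k : ℕ) (x : Ext (P.X n) Y 0) :
    ((homComplex P Y).sc' n (n + 1) k).f.hom x = (Ext.mk₀ (P.d (n + 1) n)).comp x (zero_add 0) :=
  homComplex_d_apply P Y n x

/-- **Right exactness of `Hom(–, Y)`: `Ext⁰(Qⱼ, Y) ≃+ ker(Ext⁰(Pⱼ, Y) → Ext⁰(Pⱼ₊₁, Y))`**, by
`x ↦ p_{Qⱼ} ∘ x` (inverse: descending to the cokernel `Qⱼ` of `d`).
[cite: Weibel1994, §2.4 (dimension shifting, Exercise 2.4.3)] -/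
def opcyclesExtAddEquiv (i j : ℕ) :
    Ext (P.opcycles j) Y 0 ≃+ AddMonoidHom.ker ((homComplex P Y).sc' i j (j + 1)).g.hom :=
  AddEquiv.ofBijective
    (((Ext.mk₀ (P.pOpcycles j)).precomp Y (zero_add 0)).codRestrict _ (fun x => by
      change ((homComplex P Y).sc' i j (j + 1)).g.hom ((Ext.mk₀ (P.pOpcycles j)).comp x (zero_add 0)) =
        (0 : Ext (P.X (j + 1)) Y 0)
      rw [homComplex_sc'_g_apply, Ext.mk₀_comp_mk₀_assoc, HomologicalComplex.d_pOpcycles,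
        Ext.mk₀_zero, Ext.zero_comp]))
    (by
      constructor
      · intro x y hxy
        exact Ext.precomp_mk₀_injective_of_epi Y (P.pOpcycles j) (congrArg Subtype.val hxy)
      · rintro ⟨y, hy⟩
        change Ext (P.X j) Y 0 at y
        have hy' : ((homComplex P Y).sc' i j (j + 1)).g.hom y = 0 := hy
        rw [homComplex_sc'_g_apply] at hy'
        have hy'' : P.d (j + 1) j ≫ Ext.addEquiv₀ y = 0 := by
          apply Ext.addEquiv₀.symm.injective
          rw [Ext.addEquiv₀_symm_apply, Ext.addEquiv₀_symm_apply, ← Ext.mk₀_comp_mk₀,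
            Ext.mk₀_addEquiv₀_apply, Ext.mk₀_zero]
          exact hy'
        refine ⟨Ext.mk₀ (P.descOpcycles (Ext.addEquiv₀ y) (j + 1) (ChainComplex.prev ℕ j) hy''),
          Subtype.ext ?_⟩
        change (Ext.mk₀ (P.pOpcycles j)).comp (Ext.mk₀ _) (zero_add 0) = y
        rw [Ext.mk₀_comp_mk₀, HomologicalComplex.p_descOpcycles, Ext.mk₀_addEquiv₀_apply])

/-- Formula for `opcyclesExtAddEquiv`. [cite: Weibel1994, §2.4 (dimension shifting, Exercise 2.4.3)] -/
theorem opcyclesExtAddEquiv_apply_val (i j : ℕ) (x : Ext (P.opcycles j) Y 0) :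
    (opcyclesExtAddEquiv P Y i j x).1 = (Ext.mk₀ (P.pOpcycles j)).comp x (zero_add 0) :=
  rfl

/-- Under `opcyclesExtAddEquiv`, the map `Ext⁰(Pₙ, Y) → Ext⁰(Qₙ₊₁, Y)` (precomposition with
`Qₙ₊₁ → Pₙ`) becomes `dⁿ : Ext⁰(Pₙ, Y) → ker(dⁿ⁺¹)` (Mathlib's `ShortComplex.abToCycles` of the
degree-`(n, n+1, n+2)` window of `homComplex P Y`).
[cite: Weibel1994, §2.4 (dimension shifting, Exercise 2.4.3)] -/
theorem opcyclesExtAddEquiv_precomp_fromOpcycles (n : ℕ) (x : Ext (P.X n) Y 0) :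
    opcyclesExtAddEquiv P Y n (n + 1)
        ((Ext.mk₀ (P.fromOpcycles (n + 1) n)).precomp Y (zero_add 0) x) =
      ((homComplex P Y).sc' n (n + 1) (n + 1 + 1)).abToCycles x := by
  apply Subtype.ext
  rw [opcyclesExtAddEquiv_apply_val, ShortComplex.abToCycles_apply_coe]
  change _ = ((homComplex P Y).sc' n (n + 1) (n + 1 + 1)).f.hom x
  rw [homComplex_sc'_f_apply, precomp_apply, Ext.mk₀_comp_mk₀_assoc,
    HomologicalComplex.p_fromOpcycles]

/-- Hence the image of `Ext⁰(Pₙ, Y) → Ext⁰(Qₙ₊₁, Y)` corresponds to the image of `abToCycles`.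
[cite: Weibel1994, §2.4 (dimension shifting, Exercise 2.4.3)] -/
theorem map_opcyclesExtAddEquiv_range (n : ℕ) :
    AddSubgroup.map (opcyclesExtAddEquiv P Y n (n + 1))
        ((Ext.mk₀ (P.fromOpcycles (n + 1) n)).precomp Y (zero_add 0)).range =
      ((homComplex P Y).sc' n (n + 1) (n + 1 + 1)).abToCycles.range := by
  rw [AddMonoidHom.map_range]
  ext y
  constructor
  · rintro ⟨x, rfl⟩
    exact ⟨x, (opcyclesExtAddEquiv_precomp_fromOpcycles P Y n x).symm⟩
  · rintro ⟨x, rfl⟩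
    exact ⟨x, opcyclesExtAddEquiv_precomp_fromOpcycles P Y n x⟩

/-- In the window `(0, 0, 1)` the incoming map is `d₀₀ = 0`, so `abToCycles` has trivial image.
[cite: Weibel1994, §2.4 (dimension shifting, Exercise 2.4.3)] -/
theorem abToCycles_zero_range_eq_bot :
    ((homComplex P Y).sc' 0 0 1).abToCycles.range = ⊥ := by
  rw [eq_bot_iff]
  rintro _ ⟨x, rfl⟩
  rw [AddSubgroup.mem_bot, Subtype.ext_iff, ShortComplex.abToCycles_apply_coe]
  change ((homComplex P Y).sc' 0 0 1).f.hom x = (0 : Ext (P.X 0) Y 0)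
  change ((homComplex P Y).d 0 0).hom x = 0
  rw [(homComplex P Y).shape 0 0 (by simp)]
  rfl

end HomComplex

/-! ## §5 Main results: `Extⁿ(X, Y) ≃+ Hⁿ(Ext⁰(P•, Y))` -/

section Main

variable (P : ChainComplex C ℕ) (Y : C) {X : C} (ε : P.X 0 ⟶ X) (hε : P.d 1 0 ≫ ε = 0)
  (hex : (ShortComplex.mk (P.d 1 0) ε hε).Exact)
  (hP : ∀ n, P.ExactAt (n + 1)) (hY : ∀ n q (e : Ext (P.X n) Y (q + 1)), e = 0)

/-- **`Ext⁰(X, Y) ≃+ H⁰(Ext⁰(P•, Y))`** for an exact augmentation `P₁ → P₀ —ε→ X → 0` (`ε` an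
epimorphism, `P₁ → P₀ → X` exact): `Ext⁰(X, Y) ≅ Ext⁰(Q₀, Y) = ker(Ext⁰(P₀, Y) → Ext⁰(P₁, Y)) = H⁰`.
(No acyclicity is needed in degree `0`.) [cite: Weibel1994, §2.4 (Exercise 2.4.3), Theorem 2.7.6] -/
def extAddEquivHomologyZero [Epi ε] :
    Ext X Y 0 ≃+ ((homComplex P Y).homology 0 : AddCommGrpCat.{w}) :=
  (extAddEquivOfIsoLeft (isoOpcyclesZero P ε hε hex).symm Y 0).trans <|
    (opcyclesExtAddEquiv P Y 0 0).trans <|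
      QuotientAddGroup.quotientBot.symm.trans <|
        (QuotientAddGroup.quotientAddEquivOfEq (abToCycles_zero_range_eq_bot P Y).symm).trans
          ((homComplex P Y).homologyIsoSc' 0 0 1 CochainComplex.prev_nat_zero
              (CochainComplex.next ℕ 0) ≪≫
            ShortComplex.abHomologyIso _).addCommGroupIsoToAddEquiv.symm

/-- **`Extⁿ⁺¹(X, Y) ≃+ Hⁿ⁺¹(Ext⁰(P•, Y))`** for an EXACT augmented chain complex
`⋯ → P₁ → P₀ —ε→ X → 0` (`ε` epi, `P₁ → P₀ → X` exact, `P` exact in all degrees `≥ 1`) with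
`Ext(–, Y)`-ACYCLIC terms (`Ext^{q+1}(Pₙ, Y) = 0` for all `n, q`; e.g. `Pₙ` projective):
`Extⁿ⁺¹(X, Y) ≅ Extⁿ⁺¹(Q₀, Y) ≅ Ext¹(Qₙ, Y) ≅ Ext⁰(Qₙ₊₁, Y) / Im Ext⁰(Pₙ, Y) ≅ ker dⁿ⁺¹ / Im dⁿ`.
[cite: Weibel1994, §2.4 (Exercise 2.4.3), Theorem 2.7.6] -/
def extAddEquivHomologySucc [Epi ε] (n : ℕ) :
    Ext X Y (n + 1) ≃+ ((homComplex P Y).homology (n + 1) : AddCommGrpCat.{w}) :=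
  (extAddEquivOfIsoLeft (isoOpcyclesZero P ε hε hex).symm Y (n + 1)).trans <|
    (iterShift P Y hP hY n (a := 0) (b := n + 1) (by omega)).symm.trans <|
      (extOneQuotientAddEquiv Y (opcyclesSC_shortExact P n (hP n)) (hY n 0)).trans <|
        (QuotientAddGroup.congr _ _ (opcyclesExtAddEquiv P Y n (n + 1))
            (map_opcyclesExtAddEquiv_range P Y n)).trans
          ((homComplex P Y).homologyIsoSc' n (n + 1) (n + 1 + 1) (CochainComplex.prev_nat_succ n)
              (CochainComplex.next ℕ (n + 1)) ≪≫
            ShortComplex.abHomologyIso _).addCommGroupIsoToAddEquiv.symm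

/-- Every PROJECTIVE resolution is `Ext(–, Y)`-acyclic: `Ext^{q+1}(Pₙ, Y) = 0`.
[cite: Weibel1994, §2.5 (Lemma 2.5.1 ff.)] -/
theorem ext_eq_zero_of_projective (hproj : ∀ n, Projective (P.X n)) (n q : ℕ)
    (e : Ext (P.X n) Y (q + 1)) : e = 0 :=
  haveI := hproj n
  Ext.eq_zero_of_projective e

end Main

end LeftResolution

end Literature.Algebra.Homology
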